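/-
Copyright (c) 2026 the pub-hodgecm-mathlib formalisation cell (harness21).  Prover seat hodgecm-mathlib-K2E3-p25 (g4), Track B «K2-LIT», E3 hand on loan to L1
(hLiu418 = `stmt-HodgeConjecture-24832`); LEAD F0P6-plan (g14) BATCH #105 (3) letter (V-b), line lead (K1a-GK) K2E5-p16 (g8); the LITERAL-CORNER twin of
★ p862841 `K2LiuRankOneIndexValueTwo` at `n = 2` + the `σ♭`-bridge to ★ p862643 (K1a-1).  THEOREMS ONLY (`--supports stmt-HodgeConjecture-24832 --as helper`):
no definition, no instance, no notation, no named-fact hypothesis, no `sorry`.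
-/
import Summits.HodgeConjecture.HodgeConjecture.Theorems.K2LiuRankOneIndexValue                 -- ★ (n1) `imPart_mem`, `imPart_ne_zero`, `imPart_mul_root_eq_self`
import Literature.NumberTheory.GelbartRogawski1991.LocalKudlaSplittingInjectiveTransported    -- ★ `gramR_eq_diagonal`
import HarnessLib

/-!
# Crux `HLiu418`, #42S organ S5, letter (V-b) at the LITERAL corner: `val₂′ ∕ hval₂′` on `M₂(L)` (`n = 2` after `obtain rfl`) and the bridge
# `σ♭ = α · val₂′ X · N(t)` to the corner parameter of ★ p862643 (K1a-1)

Cell `hodgecm-mathlib`, crux item hLiu418 = `stmt-HodgeConjecture-24832`; squad K2, prover K2E3-p25 (g4); count-neutral helper.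
Namespace `Summit.HodgeConjecture.HodgeConjecture.Cruxes.HLiu418.K2LiuRankOneIndexValueTwoCorner`.

WHY A TWIN (K2E3-p25 (g4) CONVENTION FLAG 2026-09-04T23:22Z).  ★ p862841 normalises the value of a rank-one skew index by the Gram entry `T_bb` at `b := e (1,0)`
(the only corner spelling available for a GENERIC index `n` with `e : Fin 2 × Fin 1 ≃ Fin n`).  The K1-a♮ organ (★ p862643 (K1a-1), (K1a-2)∕(K1a-2d)) works at
LITERAL `n = 2` (`obtain rfl : n = 2`) with the corner `Matrix.single 1 1 σ♭` — index `1 : Fin 2` whatever `e` is.  The socket quantifies over every `e`; for the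
swapped `e` the two corners differ by the non-norm `dV₀ ∕ dV₁`.  This file states the SAME recipe at the literal corner so that the K1a seam docks token for token:
  `val₂′ X := if ip (X 1 1) = 0 then (gramR 0 0 · (gramR 1 1)⁻¹) · ip (X 0 0) else ip (X 1 1)`,   `ip x := (x − c x)(2α)⁻¹ ∈ L⁺` (★ (n1) `imPart_mem`),
for `T_L := gramR ⊗ L` with `e : Fin N × Fin M ≃ Fin 2` GENERIC in `N, M` (★ `gramR_eq_diagonal`).
* §1 the diagonal datum and the skew relations at `n = 2` (`gramRL_apply`, `skew_entry`, `skew_diag_add_conj`, `diag_ne_zero_or`).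
* §2 **`hval₂_of_branches`**, **`hval₂`** (★ p862379 `hdead_of_deadFactors`' binder `hval` at `n = 2`, `val := val₂′`), **`val₂_mul_sq_mul`**
  (`val₂′ X · α² · T₁₁ = α · T_kk · X_kk` for a `k` with `X_kk ≠ 0`).
* §3 THE `σ♭`-BRIDGE **`corner_eq_val₂_mul_norm`**: for ANY `g : GL₂(L)` and `D₀` with ★ p862643's Levi relation `(c g)ᵀ · T_L · D₀ = T_L` and corner equation
  `D₀ · X · g⁻¹ = single 1 1 σ` one has `σ = α · val₂′ X · (c t · t)` for some `t ≠ 0` — the corner parameter and the value agree UP TO `α` AND A NORM from `L^×`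
  (so every hilbert symbol `(·, θ)_v`, every real sign and every inert `ord`-parity of `val₂′ X` is the corner's: the algebraic half of the (σ) seam of K2E5-p16 (g8)'s
  memo 7c6ffe77 §3).  Mechanism: `T_L · X = (c g)ᵀ · (T_L · single 1 1 σ) · g`, so `T_kk X_kk = c(g 1 k) · T₁₁ σ · g 1 k` on the diagonal, against §2.
[MoeglinWaldspurger1995, I.2.6, II.1.7] [Shimura1997, §18.1, §18.4] [KudlaRallis1994, §2–§3] [Kudla1997, §2] [Scharlau1985HermitianForms, Ch. 10 §1].

HONEST LABEL.  Count-neutral helper: `HC_CM` is proved only modulo the 7 printed citations (2 remaining named inputs: hLiu418 = `stmt-HodgeConjecture-24832`,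
h413 = `stmt-HodgeConjecture-24833`) until rung 0 closes; one by-value letter of the #42S `hdead` slot + its seam algebra; closes no socket by itself.
-/

set_option autoImplicit false
set_option linter.dupNamespace false -- the mandated namespace repeats `HodgeConjecture.HodgeConjecture`

noncomputable section

open scoped Matrix
open NumberField IsDedekindDomain
open Literature.NumberTheory.Automorphic
open Literature.NumberTheory.GelbartRogawski1991 Literature.NumberTheory.GelbartRogawski1991.GRConstruction
open Summit.HodgeConjecture.HodgeConjecture.Cruxes.HLiu418.K2LiuSiegelUnipotentFourierDefs
open Summit.HodgeConjecture.HodgeConjecture.Cruxes.HLiu418.K2LiuRankOneIndexValue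

namespace Summit.HodgeConjecture.HodgeConjecture.Cruxes.HLiu418.K2LiuRankOneIndexValueTwoCorner

variable (L : Type) [Field L] [NumberField L] [IsCMField L]
variable {N M : ℕ} (e : Fin N × Fin M ≃ Fin 2)
  (dV : Fin N → L) (hdV : ∀ i, IsCMField.complexConj L (dV i) = dV i) (hdV0 : ∀ i, dV i ≠ 0)
  (dW : Fin M → L) (hdW : ∀ i, IsCMField.complexConj L (dW i) = dW i) (hdW0 : ∀ i, dW i ≠ 0)

/-! ## §1 Skew bookkeeping on the diagonal datum `T = gramR = diag(dV·dW)` -/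

/-- **`T_L = gramR ⊗ L` IS DIAGONAL**: `T_L i j = if i = j then dV (e⁻¹ i).1 · dW (e⁻¹ i).2 else 0` (★ `gramR_eq_diagonal`).
[cite: GelbartRogawski1991, §3.1 Prop. 3.1.1 p. 455] -/
theorem gramRL_apply (i j : Fin 2) :
    ((gramR L e dV hdV dW hdW).map (algebraMap (Fp L) L)) i j = if i = j then dV (e.symm i).1 * dW (e.symm i).2 else 0 := by
  rw [gramR_eq_diagonal, Matrix.map_apply, Matrix.diagonal_apply]
  split_ifs with h
  · rfl
  · exact map_zero _

/-- the diagonal entries of `T_L`. [cite: GelbartRogawski1991, §3.1 Prop. 3.1.1 p. 455] -/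
theorem gramRL_apply_same (i : Fin 2) :
    ((gramR L e dV hdV dW hdW).map (algebraMap (Fp L) L)) i i = dV (e.symm i).1 * dW (e.symm i).2 := by
  rw [gramRL_apply, if_pos rfl]

include hdV0 hdW0 in
/-- the diagonal entries of `T_L` are non-zero. [cite: GelbartRogawski1991, §3.1 Prop. 3.1.1 p. 455] -/
theorem gramRL_apply_same_ne_zero (i : Fin 2) :
    ((gramR L e dV hdV dW hdW).map (algebraMap (Fp L) L)) i i ≠ 0 := by
  rw [gramRL_apply_same]
  exact mul_ne_zero (hdV0 _) (hdW0 _)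

/-- the diagonal entries of `T_L` are real (`c`-fixed). [cite: GelbartRogawski1991, §3.1 Prop. 3.1.1 p. 455] -/
theorem complexConj_gramRL_apply_same (i : Fin 2) :
    IsCMField.complexConj L (((gramR L e dV hdV dW hdW).map (algebraMap (Fp L) L)) i i) = ((gramR L e dV hdV dW hdW).map (algebraMap (Fp L) L)) i i := by
  rw [gramRL_apply_same, map_mul, hdV, hdW]

/-- the entry of `gramR` (over `L⁺`) at `(i,i)`, coerced to `L`, is the entry of `T_L`. [folklore] -/
theorem algebraMap_gramR_apply_same (i : Fin 2) :
    algebraMap (Fp L) L ((gramR L e dV hdV dW hdW) i i) = ((gramR L e dV hdV dW hdW).map (algebraMap (Fp L) L)) i i := by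
  rw [Matrix.map_apply]

/-- the same with the subfield coercion `L⁺ → L`. [folklore] -/
theorem coe_gramR_apply_same (i : Fin 2) :
    (((gramR L e dV hdV dW hdW) i i : Fp L) : L) = ((gramR L e dV hdV dW hdW).map (algebraMap (Fp L) L)) i i := by
  rw [Matrix.map_apply]
  rfl

include hdV0 hdW0 in
/-- the diagonal entries of `gramR` (over `L⁺`) are non-zero. [folklore] -/
theorem gramR_apply_same_ne_zero (i : Fin 2) : (gramR L e dV hdV dW hdW) i i ≠ 0 := by
  intro h
  apply gramRL_apply_same_ne_zero L e dV hdV hdV0 dW hdW hdW0 i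
  rw [← algebraMap_gramR_apply_same, h, map_zero]

/-- **THE SKEW RELATION ENTRYWISE** on the diagonal datum: `X ∈ Skew_T ⇒ T_ii · X_ij + c(X_ji) · T_jj = 0`. [cite: Shimura1997, §18.1] [cite: MoeglinWaldspurger1995, I.2.6] -/
theorem skew_entry {X : Matrix (Fin 2) (Fin 2) L}
    (hX : X ∈ skewMatrices ((IsCMField.complexConj L : L ≃ₐ[Fp L] L) : L →+* L) ((gramR L e dV hdV dW hdW).map (algebraMap (Fp L) L))) (i j : Fin 2) :
    ((gramR L e dV hdV dW hdW).map (algebraMap (Fp L) L)) i i * X i j +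
      IsCMField.complexConj L (X j i) * ((gramR L e dV hdV dW hdW).map (algebraMap (Fp L) L)) j j = 0 := by
  rw [mem_skewMatrices_iff] at hX
  have h := congrFun (congrFun hX i) j
  rw [Matrix.add_apply, gramR_eq_diagonal, Matrix.diagonal_map (map_zero _), Matrix.diagonal_mul, Matrix.mul_diagonal, Matrix.transpose_apply,
    Matrix.map_apply, Matrix.zero_apply] at h
  rw [gramR_eq_diagonal, Matrix.diagonal_map (map_zero _), Matrix.diagonal_apply_eq, Matrix.diagonal_apply_eq]
  exact h

include hdV0 hdW0 in
/-- **the diagonal entries of a skew index are purely imaginary**: `X_ii + c X_ii = 0` (`T_ii ≠ 0` real). [cite: Shimura1997, §18.1] -/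
theorem skew_diag_add_conj {X : Matrix (Fin 2) (Fin 2) L}
    (hX : X ∈ skewMatrices ((IsCMField.complexConj L : L ≃ₐ[Fp L] L) : L →+* L) ((gramR L e dV hdV dW hdW).map (algebraMap (Fp L) L))) (i : Fin 2) :
    X i i + IsCMField.complexConj L (X i i) = 0 := by
  have h := skew_entry L e dV hdV dW hdW hX i i
  rw [mul_comm (IsCMField.complexConj L (X i i)), ← mul_add] at h
  exact (mul_eq_zero.1 h).resolve_left (gramRL_apply_same_ne_zero L e dV hdV hdV0 dW hdW hdW0 i)

omit [NumberField L] [IsCMField L] in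
/-- **`det X = X₀₀ X₁₁ − X₀₁ X₁₀`** (`Matrix.det_fin_two`). [folklore] -/
theorem det_eq_two_by_two (X : Matrix (Fin 2) (Fin 2) L) : X.det = X 0 0 * X 1 1 - X 0 1 * X 1 0 :=
  Matrix.det_fin_two X

omit [NumberField L] [IsCMField L] in
/-- a `2 × 2` matrix with all four entries zero is zero. [folklore] -/
theorem eq_zero_of_entries {X : Matrix (Fin 2) (Fin 2) L} (haa : X 0 0 = 0) (hab : X 0 1 = 0) (hba : X 1 0 = 0) (hbb : X 1 1 = 0) : X = 0 := by
  ext i j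
  fin_cases i <;> fin_cases j <;> assumption

include hdV0 hdW0 in
/-- **A NON-ZERO RANK-ONE SKEW INDEX HAS A NON-ZERO DIAGONAL ENTRY**: `X ∈ Skew_T`, `X ≠ 0`, `det X = 0 ⇒ X_aa ≠ 0 ∨ X_bb ≠ 0` — if both vanish, `det X = −X_ab X_ba =
(T_aa ∕ T_bb) · X_ab · c(X_ab) = 0` forces `X_ab = 0 = X_ba`, i.e. `X = 0`. [cite: Shimura1997, §18.4] [cite: KudlaRallis1994, §2] -/
theorem diag_ne_zero_or {X : Matrix (Fin 2) (Fin 2) L}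
    (hX : X ∈ skewMatrices ((IsCMField.complexConj L : L ≃ₐ[Fp L] L) : L →+* L) ((gramR L e dV hdV dW hdW).map (algebraMap (Fp L) L))) (hX0 : X ≠ 0)
    (hdet : X.det = 0) : X 0 0 ≠ 0 ∨ X 1 1 ≠ 0 := by
  by_contra h
  push Not at h
  obtain ⟨haa, hbb⟩ := h
  -- `det X = −X_ab X_ba = 0`
  have hd : X 0 1 * X 1 0 = 0 := by
    have := det_eq_two_by_two L X
    rw [hdet, haa, zero_mul, zero_sub] at this
    exact neg_eq_zero.1 this.symm
  -- `T_bb X_ba = −T_aa c(X_ab)`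
  have hba : ((gramR L e dV hdV dW hdW).map (algebraMap (Fp L) L)) 1 1 * X 1 0 =
      -(IsCMField.complexConj L (X 0 1) * ((gramR L e dV hdV dW hdW).map (algebraMap (Fp L) L)) 0 0) :=
    eq_neg_of_add_eq_zero_left (skew_entry L e dV hdV dW hdW hX 1 0)
  have hTb := gramRL_apply_same_ne_zero L e dV hdV hdV0 dW hdW hdW0 1
  have hTa := gramRL_apply_same_ne_zero L e dV hdV hdV0 dW hdW hdW0 0
  -- multiply `hd` by `T_bb`: `X_ab · (−c(X_ab) T_aa) = 0`
  have hN : X 0 1 * IsCMField.complexConj L (X 0 1) = 0 := by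
    have h1 : X 0 1 * (((gramR L e dV hdV dW hdW).map (algebraMap (Fp L) L)) 1 1 * X 1 0) = 0 := by
      rw [mul_left_comm, hd, mul_zero]
    rw [hba, mul_neg, neg_eq_zero, ← mul_assoc, mul_eq_zero] at h1
    exact h1.resolve_right hTa
  have hab : X 0 1 = 0 := by
    rcases mul_eq_zero.1 hN with h | h
    · exact h
    · simpa using congrArg (IsCMField.complexConj L) h
  have hba0 : X 1 0 = 0 := by
    rw [hab, map_zero, zero_mul, neg_zero, mul_eq_zero] at hba
    exact hba.resolve_left hTb
  exact hX0 (eq_zero_of_entries L haa hab hba0 hbb)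

/-! ## §2 The `hval` letter at `n ≃ 2` for the corner-first value `val₂` -/

include hdV0 hdW0 in
/-- **`hval` AT `n ≃ 2`, HYPOTHESIS-FIRST ON THE TWO BRANCHES.**  Any `val : M_n(L) → L⁺` which on `T`-skew `X` equals `ip(X_bb)` when `ip(X_bb) ≠ 0` and
`(T_aa · T_bb⁻¹) · ip(X_aa)` when `ip(X_bb) = 0` (`ip x = (x − c x)(2α)⁻¹`, `α ≠ 0`) satisfies ★ p862379's binder: `X ∈ Skew_T → X ≠ 0 → det X = 0 → val X ≠ 0`.
(The tie instantiates `val` with the explicit `if`-term and discharges the two branch hypotheses by `if_neg` ∕ `if_pos`.)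
[cite: Shimura1997, §18.1, §18.4] [cite: Kudla1997, §2] [cite: KudlaRallis1994, §2] -/
theorem hval₂_of_branches {α : L} (hα0 : α ≠ 0) (hαc : IsCMField.complexConj L α = -α)
    (val : Matrix (Fin 2) (Fin 2) L → ↥(maximalRealSubfield L))
    (hb : ∀ X ∈ skewMatrices ((IsCMField.complexConj L : L ≃ₐ[Fp L] L) : L →+* L) ((gramR L e dV hdV dW hdW).map (algebraMap (Fp L) L)),
      (⟨(X 1 1 - IsCMField.complexConj L (X 1 1)) * (2 * α)⁻¹, imPart_mem L hαc _⟩ : ↥(maximalRealSubfield L)) ≠ 0 →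
        val X = ⟨(X 1 1 - IsCMField.complexConj L (X 1 1)) * (2 * α)⁻¹, imPart_mem L hαc _⟩)
    (ha : ∀ X ∈ skewMatrices ((IsCMField.complexConj L : L ≃ₐ[Fp L] L) : L →+* L) ((gramR L e dV hdV dW hdW).map (algebraMap (Fp L) L)),
      (⟨(X 1 1 - IsCMField.complexConj L (X 1 1)) * (2 * α)⁻¹, imPart_mem L hαc _⟩ : ↥(maximalRealSubfield L)) = 0 →
        val X = (gramR L e dV hdV dW hdW) 0 0 * ((gramR L e dV hdV dW hdW) 1 1)⁻¹ *
          ⟨(X 0 0 - IsCMField.complexConj L (X 0 0)) * (2 * α)⁻¹, imPart_mem L hαc _⟩) :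
    ∀ X ∈ skewMatrices ((IsCMField.complexConj L : L ≃ₐ[Fp L] L) : L →+* L) ((gramR L e dV hdV dW hdW).map (algebraMap (Fp L) L)),
      X ≠ 0 → X.det = 0 → val X ≠ 0 := by
  intro X hX hX0 hdet
  by_cases hbr : (⟨(X 1 1 - IsCMField.complexConj L (X 1 1)) * (2 * α)⁻¹, imPart_mem L hαc _⟩ :
      ↥(maximalRealSubfield L)) = 0
  · -- corner entry vanishes: `X_bb = 0`, hence `X_aa ≠ 0`, and `val X = (T_aa ∕ T_bb) · ip(X_aa) ≠ 0`
    rw [ha X hX hbr]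
    have hbb : X 1 1 = 0 := by
      by_contra hbb
      exact imPart_ne_zero L hα0 hbb (skew_diag_add_conj L e dV hdV hdV0 dW hdW hdW0 hX 1) (congrArg Subtype.val hbr)
    have haa : X 0 0 ≠ 0 := (diag_ne_zero_or L e dV hdV hdV0 dW hdW hdW0 hX hX0 hdet).resolve_right (not_not.2 hbb)
    refine mul_ne_zero (mul_ne_zero (gramR_apply_same_ne_zero L e dV hdV hdV0 dW hdW hdW0 _)
      (inv_ne_zero (gramR_apply_same_ne_zero L e dV hdV hdV0 dW hdW hdW0 _))) ?_
    intro h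
    exact imPart_ne_zero L hα0 haa (skew_diag_add_conj L e dV hdV hdV0 dW hdW hdW0 hX 0) (congrArg Subtype.val h)
  · rw [hb X hX hbr]
    exact hbr

include hdV0 hdW0 in
open scoped Classical in
/-- **THE `hval` LETTER AT `n ≃ 2` FOR THE EXPLICIT CORNER-FIRST VALUE** `val₂ X := if ip(X_bb) = 0 then (T_aa · T_bb⁻¹) · ip(X_aa) else ip(X_bb)` — ★ p862379
`hdead_of_deadFactors`' binder `hval` BYTES at `val := val₂` (classical decidability of the `if`, as the tie pastes it).
[cite: Shimura1997, §18.1, §18.4] [cite: Kudla1997, §2] [cite: KudlaRallis1994, §2] -/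
theorem hval₂ {α : L} (hα0 : α ≠ 0) (hαc : IsCMField.complexConj L α = -α) :
    ∀ X ∈ skewMatrices ((IsCMField.complexConj L : L ≃ₐ[Fp L] L) : L →+* L) ((gramR L e dV hdV dW hdW).map (algebraMap (Fp L) L)),
      X ≠ 0 → X.det = 0 →
        (if (⟨(X 1 1 - IsCMField.complexConj L (X 1 1)) * (2 * α)⁻¹, imPart_mem L hαc _⟩ : ↥(maximalRealSubfield L)) = 0 then
            (gramR L e dV hdV dW hdW) 0 0 * ((gramR L e dV hdV dW hdW) 1 1)⁻¹ *
              (⟨(X 0 0 - IsCMField.complexConj L (X 0 0)) * (2 * α)⁻¹, imPart_mem L hαc _⟩ : ↥(maximalRealSubfield L))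
          else ⟨(X 1 1 - IsCMField.complexConj L (X 1 1)) * (2 * α)⁻¹, imPart_mem L hαc _⟩) ≠ 0 :=
  hval₂_of_branches L e dV hdV hdV0 dW hdW hdW0 hα0 hαc _ (fun _ _ h => if_neg h) (fun _ _ h => if_pos h)

include hdV0 hdW0 in
open scoped Classical in
/-- **`val₂ X · α² · T_bb = α · T_kk · X_kk` FOR A DIAGONAL ENTRY `X_kk ≠ 0`** (`k = b` on the corner branch, `k = a` on the other): in both branches `val₂ X · θ · T_bb`
is a non-zero diagonal entry `β_kk` of the `c`-hermitian rank-one matrix `β = α·T·X`, hence (★ `K2LiuRankOneLineGram`) a Gram value of the index — its NORM CLASS.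
[cite: KudlaRallis1994, §3] [cite: Scharlau1985HermitianForms, Ch. 10 §1] [cite: Shimura1997, §18.4] -/
theorem val₂_mul_sq_mul {α : L} (hα0 : α ≠ 0) (hαc : IsCMField.complexConj L α = -α) {X : Matrix (Fin 2) (Fin 2) L}
    (hX : X ∈ skewMatrices ((IsCMField.complexConj L : L ≃ₐ[Fp L] L) : L →+* L) ((gramR L e dV hdV dW hdW).map (algebraMap (Fp L) L))) (hX0 : X ≠ 0)
    (hdet : X.det = 0) :
    ∃ k : Fin 2, X k k ≠ 0 ∧
      ((if (⟨(X 1 1 - IsCMField.complexConj L (X 1 1)) * (2 * α)⁻¹, imPart_mem L hαc _⟩ : ↥(maximalRealSubfield L)) = 0 then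
            (gramR L e dV hdV dW hdW) 0 0 * ((gramR L e dV hdV dW hdW) 1 1)⁻¹ *
              (⟨(X 0 0 - IsCMField.complexConj L (X 0 0)) * (2 * α)⁻¹, imPart_mem L hαc _⟩ : ↥(maximalRealSubfield L))
          else ⟨(X 1 1 - IsCMField.complexConj L (X 1 1)) * (2 * α)⁻¹, imPart_mem L hαc _⟩ : ↥(maximalRealSubfield L)) : L) *
          α ^ 2 * ((gramR L e dV hdV dW hdW).map (algebraMap (Fp L) L)) 1 1 =
        α * ((gramR L e dV hdV dW hdW).map (algebraMap (Fp L) L)) k k * X k k := by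
  by_cases hbr : (⟨(X 1 1 - IsCMField.complexConj L (X 1 1)) * (2 * α)⁻¹, imPart_mem L hαc _⟩ :
      ↥(maximalRealSubfield L)) = 0
  · -- branch `a`
    have hbb : X 1 1 = 0 := by
      by_contra hbb
      exact imPart_ne_zero L hα0 hbb (skew_diag_add_conj L e dV hdV hdV0 dW hdW hdW0 hX 1) (congrArg Subtype.val hbr)
    have haa : X 0 0 ≠ 0 := (diag_ne_zero_or L e dV hdV hdV0 dW hdW hdW0 hX hX0 hdet).resolve_right (not_not.2 hbb)
    refine ⟨0, haa, ?_⟩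
    have hmk : ((⟨(X 0 0 - IsCMField.complexConj L (X 0 0)) * (2 * α)⁻¹, imPart_mem L hαc _⟩ :
        ↥(maximalRealSubfield L)) : L) = (X 0 0 - IsCMField.complexConj L (X 0 0)) * (2 * α)⁻¹ := rfl
    rw [if_pos hbr, Subfield.coe_mul, Subfield.coe_mul, Subfield.coe_inv, coe_gramR_apply_same, coe_gramR_apply_same, hmk]
    have hTb := gramRL_apply_same_ne_zero L e dV hdV hdV0 dW hdW hdW0 1
    have hip := imPart_mul_root_eq_self L hα0 (skew_diag_add_conj L e dV hdV hdV0 dW hdW hdW0 hX 0)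
    calc _ = ((gramR L e dV hdV dW hdW).map (algebraMap (Fp L) L)) 0 0 *
          ((X 0 0 - IsCMField.complexConj L (X 0 0)) * (2 * α)⁻¹ * α) * α *
          ((((gramR L e dV hdV dW hdW).map (algebraMap (Fp L) L)) 1 1)⁻¹ *
            ((gramR L e dV hdV dW hdW).map (algebraMap (Fp L) L)) 1 1) := by ring
      _ = _ := by rw [hip, inv_mul_cancel₀ hTb, mul_one]; ring
  · -- branch `b`
    have hbb : X 1 1 ≠ 0 := by
      intro hbb
      apply hbr
      apply Subtype.ext
      change (X 1 1 - IsCMField.complexConj L (X 1 1)) * (2 * α)⁻¹ = 0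
      rw [hbb, map_zero, sub_zero, zero_mul]
    refine ⟨1, hbb, ?_⟩
    have hmk : ((⟨(X 1 1 - IsCMField.complexConj L (X 1 1)) * (2 * α)⁻¹, imPart_mem L hαc _⟩ :
        ↥(maximalRealSubfield L)) : L) = (X 1 1 - IsCMField.complexConj L (X 1 1)) * (2 * α)⁻¹ := rfl
    rw [if_neg hbr, hmk]
    have hip := imPart_mul_root_eq_self L hα0 (skew_diag_add_conj L e dV hdV hdV0 dW hdW hdW0 hX 1)
    calc _ = ((X 1 1 - IsCMField.complexConj L (X 1 1)) * (2 * α)⁻¹ * α) * α *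
          ((gramR L e dV hdV dW hdW).map (algebraMap (Fp L) L)) 1 1 := by ring
      _ = _ := by rw [hip]; ring


/-! ## §3 The bridge to the corner parameter `σ♭` of ★ p862643 (K1a-1) -/

/-- `T_L` is diagonal: `(T_L · X) i j = T_L i i · X i j`. [folklore] -/
theorem gramRL_mul_apply (X : Matrix (Fin 2) (Fin 2) L) (i j : Fin 2) :
    ((gramR L e dV hdV dW hdW).map (algebraMap (Fp L) L) * X) i j = ((gramR L e dV hdV dW hdW).map (algebraMap (Fp L) L)) i i * X i j := by
  rw [gramR_eq_diagonal, Matrix.diagonal_map (map_zero _), Matrix.diagonal_mul, Matrix.diagonal_apply_eq]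

/-- `T_L · single 1 1 σ` read on the diagonal after the congruence by `g`: `((c g)ᵀ · (T_L · single 1 1 σ) · g) k k = c(g 1 k) · T₁₁ · σ · g 1 k`
(`T_L` diagonal, so `(T_L · single 1 1 σ) i j = 0` unless `i = j = 1`). [cite: MoeglinWaldspurger1995, II.1.7] -/
theorem conj_single_apply_same (σ : L) (g : Matrix (Fin 2) (Fin 2) L) (k : Fin 2) :
    (((g.map ((IsCMField.complexConj L : L ≃ₐ[Fp L] L) : L →+* L))ᵀ * ((gramR L e dV hdV dW hdW).map (algebraMap (Fp L) L) * Matrix.single 1 1 σ) * g :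
        Matrix (Fin 2) (Fin 2) L) k k) =
      IsCMField.complexConj L (g 1 k) * ((gramR L e dV hdV dW hdW).map (algebraMap (Fp L) L)) 1 1 * σ * g 1 k := by
  have hs00 : Matrix.single (1 : Fin 2) (1 : Fin 2) σ 0 0 = 0 := Matrix.single_apply_of_ne _ _ _ _ _ (by decide)
  have hs01 : Matrix.single (1 : Fin 2) (1 : Fin 2) σ 0 1 = 0 := Matrix.single_apply_of_ne _ _ _ _ _ (by decide)
  have hs10 : Matrix.single (1 : Fin 2) (1 : Fin 2) σ 1 0 = 0 := Matrix.single_apply_of_ne _ _ _ _ _ (by decide)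
  have hs11 : Matrix.single (1 : Fin 2) (1 : Fin 2) σ 1 1 = σ := Matrix.single_apply_same _ _ _
  have hT01 : (gramR L e dV hdV dW hdW) 0 1 = 0 := by rw [gramR_eq_diagonal, Matrix.diagonal_apply_ne _ (by decide)]
  have hT10 : (gramR L e dV hdV dW hdW) 1 0 = 0 := by rw [gramR_eq_diagonal, Matrix.diagonal_apply_ne _ (by decide)]
  simp only [Matrix.mul_apply, Fin.sum_univ_two, Matrix.transpose_apply, Matrix.map_apply, RingHom.coe_coe, hs00, hs01, hs10, hs11, hT01, hT10,
    map_zero]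
  ring

include hdV0 hdW0 in
open scoped Classical in
/-- **THE `σ♭`-BRIDGE.**  Let `X ∈ Skew_T(L)` be a non-zero rank-one index (`det X = 0`), `g ∈ GL₂(L)` and `D₀ ∈ M₂(L)` with the LEVI RELATION
`(c g)ᵀ · T_L · D₀ = T_L` and the CORNER EQUATION `D₀ · X · g⁻¹ = single 1 1 σ` (★ p862643 `conj_index_eq_single` ∕ `exists_corner_index_whittakerDelta_eq`,
`g = γ[w]`).  Then `σ = α · val₂′ X · (c t · t)` for some `t ∈ L`, `t ≠ 0`: the corner parameter and the value of record agree up to `α` and a NORM.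
Proof: `T_L X = (c g)ᵀ (T_L · single 1 1 σ) g`, whose `(k,k)` entry is `N(g 1 k) · T₁₁ σ`; compare with ★ §2 `val₂′ X · α² · T₁₁ = α T_kk X_kk` and take `t := (g 1 k)⁻¹`.
[cite: KudlaRallis1994, §2–§3] [cite: MoeglinWaldspurger1995, II.1.7] [cite: Scharlau1985HermitianForms, Ch. 10 §1] -/
theorem corner_eq_val₂_mul_norm {α : L} (hα0 : α ≠ 0) (hαc : IsCMField.complexConj L α = -α) {X : Matrix (Fin 2) (Fin 2) L}
    (hX : X ∈ skewMatrices ((IsCMField.complexConj L : L ≃ₐ[Fp L] L) : L →+* L) ((gramR L e dV hdV dW hdW).map (algebraMap (Fp L) L))) (hX0 : X ≠ 0)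
    (hdet : X.det = 0) (g : GL (Fin 2) L) {D₀ : Matrix (Fin 2) (Fin 2) L}
    (hLevi : ((g : Matrix (Fin 2) (Fin 2) L).map ((IsCMField.complexConj L : L ≃ₐ[Fp L] L) : L →+* L))ᵀ * (gramR L e dV hdV dW hdW).map (algebraMap (Fp L) L) * D₀ =
      (gramR L e dV hdV dW hdW).map (algebraMap (Fp L) L))
    {σ : L} (hcorner : D₀ * X * ((g : Matrix (Fin 2) (Fin 2) L))⁻¹ = Matrix.single 1 1 σ) :
    ∃ t : L, t ≠ 0 ∧ σ = α *
      ((if (⟨(X 1 1 - IsCMField.complexConj L (X 1 1)) * (2 * α)⁻¹, imPart_mem L hαc _⟩ : ↥(maximalRealSubfield L)) = 0 then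
            (gramR L e dV hdV dW hdW) 0 0 * ((gramR L e dV hdV dW hdW) 1 1)⁻¹ *
              (⟨(X 0 0 - IsCMField.complexConj L (X 0 0)) * (2 * α)⁻¹, imPart_mem L hαc _⟩ : ↥(maximalRealSubfield L))
          else ⟨(X 1 1 - IsCMField.complexConj L (X 1 1)) * (2 * α)⁻¹, imPart_mem L hαc _⟩ : ↥(maximalRealSubfield L)) : L) *
      (IsCMField.complexConj L t * t) := by
  -- the corner equation without the inverse: `D₀ X = single 1 1 σ · g`
  have hginv : ((g : Matrix (Fin 2) (Fin 2) L))⁻¹ * (g : Matrix (Fin 2) (Fin 2) L) = 1 :=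
    Matrix.nonsing_inv_mul _ ((Matrix.isUnit_iff_isUnit_det _).1 (Units.isUnit g))
  have hDX : D₀ * X = Matrix.single 1 1 σ * (g : Matrix (Fin 2) (Fin 2) L) := by
    have := congrArg (fun A => A * (g : Matrix (Fin 2) (Fin 2) L)) hcorner
    simpa only [Matrix.mul_assoc, hginv, Matrix.mul_one] using this
  -- `T_L X = (c g)ᵀ (T_L single 1 1 σ) g`
  have hTX : (gramR L e dV hdV dW hdW).map (algebraMap (Fp L) L) * X =
      ((g : Matrix (Fin 2) (Fin 2) L).map ((IsCMField.complexConj L : L ≃ₐ[Fp L] L) : L →+* L))ᵀ *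
        ((gramR L e dV hdV dW hdW).map (algebraMap (Fp L) L) * Matrix.single 1 1 σ) * (g : Matrix (Fin 2) (Fin 2) L) := by
    calc (gramR L e dV hdV dW hdW).map (algebraMap (Fp L) L) * X
        = (((g : Matrix (Fin 2) (Fin 2) L).map ((IsCMField.complexConj L : L ≃ₐ[Fp L] L) : L →+* L))ᵀ * (gramR L e dV hdV dW hdW).map (algebraMap (Fp L) L) * D₀) * X := by
          rw [hLevi]
      _ = ((g : Matrix (Fin 2) (Fin 2) L).map ((IsCMField.complexConj L : L ≃ₐ[Fp L] L) : L →+* L))ᵀ * (gramR L e dV hdV dW hdW).map (algebraMap (Fp L) L) * (D₀ * X) := by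
          simp only [Matrix.mul_assoc]
      _ = _ := by rw [hDX]; simp only [Matrix.mul_assoc]
  -- the branch index `k` of `val₂′` and the diagonal comparison
  obtain ⟨k, hXk, hval⟩ := val₂_mul_sq_mul L e dV hdV hdV0 dW hdW hdW0 hα0 hαc hX hX0 hdet
  have hdiag : ((gramR L e dV hdV dW hdW).map (algebraMap (Fp L) L)) k k * X k k =
      IsCMField.complexConj L ((g : Matrix (Fin 2) (Fin 2) L) 1 k) * ((gramR L e dV hdV dW hdW).map (algebraMap (Fp L) L)) 1 1 * σ * (g : Matrix (Fin 2) (Fin 2) L) 1 k := by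
    have h := congrFun (congrFun hTX k) k
    rw [gramRL_mul_apply] at h
    rw [h]
    exact conj_single_apply_same L e dV hdV dW hdW σ _ k
  have hT1 := gramRL_apply_same_ne_zero L e dV hdV hdV0 dW hdW hdW0 1
  -- abbreviate the value
  set v : L := ((if (⟨(X 1 1 - IsCMField.complexConj L (X 1 1)) * (2 * α)⁻¹, imPart_mem L hαc _⟩ : ↥(maximalRealSubfield L)) = 0 then
            (gramR L e dV hdV dW hdW) 0 0 * ((gramR L e dV hdV dW hdW) 1 1)⁻¹ *
              (⟨(X 0 0 - IsCMField.complexConj L (X 0 0)) * (2 * α)⁻¹, imPart_mem L hαc _⟩ : ↥(maximalRealSubfield L))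
          else ⟨(X 1 1 - IsCMField.complexConj L (X 1 1)) * (2 * α)⁻¹, imPart_mem L hαc _⟩ : ↥(maximalRealSubfield L)) : L) with hv
  -- `v α² T₁₁ = α T_kk X_kk = α N(g 1 k) T₁₁ σ` ⇒ `v α = N(g 1 k) σ`
  have hkey : v * α = IsCMField.complexConj L ((g : Matrix (Fin 2) (Fin 2) L) 1 k) * (g : Matrix (Fin 2) (Fin 2) L) 1 k * σ := by
    have h1 : v * α ^ 2 * ((gramR L e dV hdV dW hdW).map (algebraMap (Fp L) L)) 1 1 =
        α * (IsCMField.complexConj L ((g : Matrix (Fin 2) (Fin 2) L) 1 k) * ((gramR L e dV hdV dW hdW).map (algebraMap (Fp L) L)) 1 1 * σ *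
          (g : Matrix (Fin 2) (Fin 2) L) 1 k) := by
      rw [hval, mul_assoc α, hdiag]
    have h2 : (v * α - IsCMField.complexConj L ((g : Matrix (Fin 2) (Fin 2) L) 1 k) * (g : Matrix (Fin 2) (Fin 2) L) 1 k * σ) *
        (α * ((gramR L e dV hdV dW hdW).map (algebraMap (Fp L) L)) 1 1) = 0 := by
      linear_combination h1
    rcases mul_eq_zero.1 h2 with h | h
    · exact sub_eq_zero.1 h
    · exact absurd h (mul_ne_zero hα0 hT1)
  -- `v α ≠ 0`, so `g 1 k ≠ 0`
  have hv0 : v ≠ 0 := by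
    have := hval₂ L e dV hdV hdV0 dW hdW hdW0 hα0 hαc X hX hX0 hdet
    rw [hv]
    exact fun h => this (Subtype.ext (by simpa using h))
  have hgk : (g : Matrix (Fin 2) (Fin 2) L) 1 k ≠ 0 := by
    intro h0
    rw [h0, mul_zero, zero_mul] at hkey
    exact mul_ne_zero hv0 hα0 hkey
  refine ⟨((g : Matrix (Fin 2) (Fin 2) L) 1 k)⁻¹, inv_ne_zero hgk, ?_⟩
  have hcgk : IsCMField.complexConj L ((g : Matrix (Fin 2) (Fin 2) L) 1 k) ≠ 0 := fun h => hgk (by simpa using congrArg (IsCMField.complexConj L) h)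
  have hN : IsCMField.complexConj L ((g : Matrix (Fin 2) (Fin 2) L) 1 k) * (g : Matrix (Fin 2) (Fin 2) L) 1 k ≠ 0 := mul_ne_zero hcgk hgk
  rw [map_inv₀]
  calc σ = IsCMField.complexConj L ((g : Matrix (Fin 2) (Fin 2) L) 1 k) * (g : Matrix (Fin 2) (Fin 2) L) 1 k * σ /
        (IsCMField.complexConj L ((g : Matrix (Fin 2) (Fin 2) L) 1 k) * (g : Matrix (Fin 2) (Fin 2) L) 1 k) := (mul_div_cancel_left₀ σ hN).symm
    _ = v * α / (IsCMField.complexConj L ((g : Matrix (Fin 2) (Fin 2) L) 1 k) * (g : Matrix (Fin 2) (Fin 2) L) 1 k) := by rw [← hkey]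
    _ = _ := by rw [div_eq_mul_inv, mul_inv, mul_comm v α]

end Summit.HodgeConjecture.HodgeConjecture.Cruxes.HLiu418.K2LiuRankOneIndexValueTwoCorner

end
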